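import Literature.Topology.FourManifolds.LevelTranslation
import Literature.Topology.FourManifolds.GradientLikeExistence
import Literature.Topology.FourManifolds.MorseProofs
import Literature.AlgebraicTopology.SingularHomology.CohomologyMayerVietorisSurjective
import HarnessLib

/-!
# Cohomology classes on a regular level of a Morse function on a cobordism are sums of
# restrictions from the two sides, when the cohomology of the cobordism vanishes one degree up

Topic `Literature/Topology/FourManifolds` (barrier seat
`provefact-Literature.Barriers.SmoothPoincare4.Stab-ad8c696e34`; step B of the level-parity
programme of `HCobordismLevelParity.lean`).  For a Morse function `g` on a cobordism
`c = (W; M, N)` (Milnor, *Lectures on the h-cobordism theorem* (1965), Def. 2.3/3.1) and a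
non-critical level `b ∈ (0, 1)`, cut `W = W≤ ∪_{V} W≥` along the level `V = g⁻¹(b)`.  The
Mayer–Vietoris sequence of the open cover `{g < b + δ} ∪ {g > b − δ}` (Hatcher, *Algebraic
Topology* (2002), §3.1 pp. 203–204), whose overlap — the thin slab `g⁻¹(b − δ, b + δ)` without
critical values — retracts onto the level along the trajectories of a gradient-like field
(Milnor 1965, Lemma 3.2, Thm. 3.4, Lemma 4.7: the tree's `Cobordism.Milnor1965_exists_isGradientLike_holds`,
`Cobordism.IsMorseFunction.exists_slabFlow`, `Flow.levelProj`), gives: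

* `Cobordism.IsMorseFunction.exists_level_eq_map_add_map` — **if `H^{p+1}(W; R) = 0`, every
  class of `Hᵖ(↥(g⁻¹(b)); R)` is the sum of a class restricted from the lower slab
  `↥(g⁻¹[a₀, b])` and a class restricted from the upper slab `↥(g⁻¹[b, a₁])`** (any
  `a₀ ≤ b ≤ a₁`; pull-backs along the inclusions of subsets of `W`).

This is the spanning hypothesis of `isEven_intersectionForm_of_cobordisms`
(`HCobordismLevelParity.lean`) for the two slab cobordisms of `RegularSlabCobordism.lean`; for
an h-cobordism `W` between simply connected closed 4-manifolds `H³(W; ℤ) ≅ H³(X₁; ℤ) = 0`.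
Everything is proved; no named fact is introduced.

## References

* J. Milnor, *Lectures on the h-cobordism theorem* (1965), Def. 2.3, Lemma 3.2, Thm. 3.4,
  Lemma 4.7 (PDF pp. 11–13, 25). [MilnorHCobordism1965]
* A. Hatcher, *Algebraic Topology*, CUP 2002, §3.1 pp. 203–204. [HatcherAT2002]
-/

open scoped Manifold ContDiff Topology
open Set Function Filter
open Literature.AlgebraicTopology.SingularHomology

noncomputable section

namespace Literature.Topology.FourManifolds

universe u v

variable {n : ℕ} {M N : Type u} [TopologicalSpace M] [ChartedSpace (EuclideanSpace ℝ (Fin n)) M]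
  [TopologicalSpace N] [ChartedSpace (EuclideanSpace ℝ (Fin n)) N]

/-- **A non-critical level is isolated among the critical values** (Milnor 1965, Lemma 2.9
setting: finitely many critical points, `IsMorse.finite_criticalSet_holds`): for a Morse
function `g` on a cobordism and a non-critical value `b ∈ (0, 1)` there is `δ > 0` with
`[b − δ, b + δ] ⊆ (0, 1)` free of critical values. [cite: MilnorHCobordism1965, Lemma 2.9 (PDF p. 11)] -/
theorem Cobordism.IsMorseFunction.exists_Icc_free {c : Cobordism n M N} {g : c.W → ℝ}
    (hg : c.IsMorseFunction g) {b : ℝ} (hb0 : 0 < b) (hb1 : b < 1)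
    (hreg : ∀ z ∈ criticalSet (𝓡∂ (n + 1)) g, g z ≠ b) :
    ∃ δ : ℝ, 0 < δ ∧ 0 < b - δ ∧ b + δ < 1 ∧
      ∀ z, IsMCriticalPt (𝓡∂ (n + 1)) g z → g z ∉ Icc (b - δ) (b + δ) := by
  have hfin : (g '' criticalSet (𝓡∂ (n + 1)) g).Finite :=
    (IsMorse.finite_criticalSet_holds hg.isMorse).image g
  have hb : b ∈ (g '' criticalSet (𝓡∂ (n + 1)) g)ᶜ := by
    rintro ⟨z, hz, hzb⟩
    exact hreg z hz hzb
  obtain ⟨ε, hε, hball⟩ := Metric.isOpen_iff.1 hfin.isClosed.isOpen_compl b hb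
  refine ⟨min (ε / 2) (min (b / 2) ((1 - b) / 2)), by positivity, ?_, ?_, ?_⟩
  · have := min_le_right (ε / 2) (min (b / 2) ((1 - b) / 2))
    have := min_le_left (b / 2) ((1 - b) / 2)
    linarith
  · have := min_le_right (ε / 2) (min (b / 2) ((1 - b) / 2))
    have := min_le_right (b / 2) ((1 - b) / 2)
    linarith
  · intro z hz hzI
    have hzball : g z ∈ Metric.ball b ε := by
      rw [Metric.mem_ball, Real.dist_eq, abs_lt]
      have := min_le_left (ε / 2) (min (b / 2) ((1 - b) / 2))
      constructor <;> linarith [hzI.1, hzI.2]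
    exact hball hzball ⟨z, hz, rfl⟩

/-- **Classes on a regular level are sums of restrictions from the two sides** (Mayer–Vietoris,
Hatcher 2002 §3.1 pp. 203–204, for the cover `{g < b + δ} ∪ {g > b − δ}` of `W`, whose overlap
retracts onto the level `g⁻¹(b)` along the trajectories of a gradient-like field, Milnor 1965
Lemma 3.2, Thm. 3.4, Lemma 4.7).  For a Morse function `g` on a cobordism `c = (W; M, N)`, a
non-critical value `b ∈ (0, 1)`, levels `a₀ ≤ b ≤ a₁`, and a degree `p` with `H^{p+1}(W; R) = 0`:
every `x ∈ Hᵖ(↥(g⁻¹(b)); R)` is `j₁^* y₁ + j₂^* y₂` with `y₁ ∈ Hᵖ(↥(g⁻¹[a₀, b]); R)`,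
`y₂ ∈ Hᵖ(↥(g⁻¹[b, a₁]); R)` and `j₁`, `j₂` the inclusions of the level in the two slabs.
[cite: HatcherAT2002, §3.1 pp. 203–204] [cite: MilnorHCobordism1965, Lemma 3.2, Thm. 3.4, Lemma 4.7 (PDF pp. 12, 25)] -/
theorem Cobordism.IsMorseFunction.exists_level_eq_map_add_map (R : Type v) [CommRing R]
    {c : Cobordism n M N} {g : c.W → ℝ} (hg : c.IsMorseFunction g) {b : ℝ} (hb0 : 0 < b)
    (hb1 : b < 1) (hreg : ∀ z ∈ criticalSet (𝓡∂ (n + 1)) g, g z ≠ b) {a₀ a₁ : ℝ} (ha₀ : a₀ ≤ b)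
    (ha₁ : b ≤ a₁) {p : ℕ} (hZ : CategoryTheory.Limits.IsZero (singularCohomology R R c.W (p + 1)))
    (x : singularCohomology R R (↥(g ⁻¹' {b})) p) :
    ∃ (y₁ : singularCohomology R R (↥(g ⁻¹' Icc a₀ b)) p)
      (y₂ : singularCohomology R R (↥(g ⁻¹' Icc b a₁)) p),
      x = singularCohomology.map R R (ContinuousMap.inclusion
            (show g ⁻¹' {b} ⊆ g ⁻¹' Icc a₀ b from fun z hz => by
              rw [mem_preimage, mem_singleton_iff] at hz; exact ⟨hz ▸ ha₀, hz.le⟩)) p y₁ +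
        singularCohomology.map R R (ContinuousMap.inclusion
            (show g ⁻¹' {b} ⊆ g ⁻¹' Icc b a₁ from fun z hz => by
              rw [mem_preimage, mem_singleton_iff] at hz; exact ⟨hz.ge, hz ▸ ha₁⟩)) p y₂ := by
  have hgc : Continuous g := hg.isMorse.contMDiff.continuous
  -- a thin slab about the level without critical values, and the flow of a gradient-like field
  obtain ⟨δ, hδ, hδ0, hδ1, hregI⟩ := hg.exists_Icc_free hb0 hb1 hreg
  obtain ⟨ξ, hξ⟩ := Cobordism.Milnor1965_exists_isGradientLike_holds hg
  obtain ⟨θ, hθ⟩ := hg.exists_slabFlow ξ.contMDiff hξ hδ0 (by linarith : b - δ < b + δ) hδ1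
  have hbI : b ∈ Icc (b - δ) (b + δ) := ⟨by linarith, by linarith⟩
  -- the open cover `{g < b + δ} ∪ {g > b - δ}` and its overlap, which contains the level
  set A : Set c.W := g ⁻¹' Iio (b + δ) with hAdef
  set B : Set c.W := g ⁻¹' Ioi (b - δ) with hBdef
  have hA : IsOpen A := isOpen_Iio.preimage hgc
  have hB : IsOpen B := isOpen_Ioi.preimage hgc
  have hAB : A ∪ B = univ := by
    refine eq_univ_of_forall fun z => ?_
    by_cases hz : g z < b + δ
    · exact Or.inl hz
    · exact Or.inr (show b - δ < g z by linarith [not_lt.1 hz])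
  have hS : g ⁻¹' {b} ⊆ A ∩ B := by
    intro z hz
    rw [mem_preimage, mem_singleton_iff] at hz
    exact ⟨show g z < b + δ by linarith, show b - δ < g z by linarith⟩
  have hzI : ∀ z : ↥(A ∩ B), g z.1 ∈ Icc (b - δ) (b + δ) := fun z =>
    ⟨le_of_lt (show b - δ < g z.1 from z.2.2), le_of_lt (show g z.1 < b + δ from z.2.1)⟩
  -- the retraction of the overlap onto the level along the trajectories
  have hcont : Continuous fun z : ↥(A ∩ B) => Flow.levelProj θ g b z.1 :=
    continuous_iff_continuousAt.2 fun z =>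
      (hθ.continuousAt_levelProj hregI (hzI z) hbI).comp continuous_subtype_val.continuousAt
  let r : C(↥(A ∩ B), ↥(g ⁻¹' {b})) :=
    ⟨fun z => ⟨Flow.levelProj θ g b z.1, hθ.toPreSlabFlow.apply_levelProj hregI (hzI z) hbI⟩,
      hcont.subtype_mk _⟩
  have hr : ∀ s : ↥(g ⁻¹' {b}), r (inclusion hS s) = s := fun s =>
    Subtype.ext (hθ.toPreSlabFlow.levelProj_of_apply_eq hregI hbI s.2)
  -- Mayer–Vietoris
  obtain ⟨a, a', hx⟩ :=
    singularCohomology.exists_eq_map_add_map_of_retract R hA hB hAB hS r hr hZ x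
  -- restrict through the two compact slabs
  have h₁A : g ⁻¹' Icc a₀ b ⊆ A := fun z hz => show g z < b + δ by linarith [hz.2]
  have h₂B : g ⁻¹' Icc b a₁ ⊆ B := fun z hz => show b - δ < g z by linarith [hz.1]
  refine ⟨singularCohomology.map R R (ContinuousMap.inclusion h₁A) p a,
    singularCohomology.map R R (ContinuousMap.inclusion h₂B) p a', ?_⟩
  rw [hx, ← ModuleCat.comp_apply, ← ModuleCat.comp_apply, ← singularCohomology.map_comp,
    ← singularCohomology.map_comp]
  rfl

end Literature.Topology.FourManifolds

end
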